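import Mathlib
import HarnessLib
import Summits.HubbardSuperconductivity.HubbardSuperconductivity.Theorems.KLProgrammeKLRegimeTwoVolumeGridProfile
import Summits.HubbardSuperconductivity.HubbardSuperconductivity.Theorems.KLProgrammeKLRegimeFrameShellCount

/-!
# One-volume scale-`0` grid data at the bare frame (β′ two-volume pass, inputs of `abs_klLocalPart_flowFrame_zero_sub_le_of_gridData`)

For ONE volume `L`, cutoff `M`, grid `N = 2(2M)` and the bare frame `K₀ = 0`, the grid covariance `G = S_Lᵀ C⁰_{>e₀} S_L` is
replica-Gram-bounded with constant `κ₀ = √(2(7+6047))` (`isGramBoundedR_scaleZero_of_frameOK_sharp`, `klBetaMin ≤ β ≤ L`, given the bare frame's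
admissibility `FrameOK R U Nfr μ 0` — `klFrameOK_zeroC` on `klWindowC`), and — given its `gridLabelWt`-pair-weighted row/column sums `≤ αw` (the (E4)₀ currency of `twoLegStepV17F_zero_bareFrame`,
`k = 1`) and the smallness `θ₀ = e·αw·normV(κ₀, ρ, Nv)/κ₀² < 1` — the grid partition function of the BARE grid interaction is a unit and the
`(1 + diam_{tnorm})`-weighted pinned profile of `effAction G V_N` is `≤ ρ^{-2m′}·e·normV(κ₀, ρ, Nv)/(1−θ₀)` in every even degree (the `Nw` /
`Nw₁` / `hZ` inputs of the β′ doors).  `Nv` is the grid vertex profile (`Nv 2 = |U||β|/N`; the counterterm slot `Nv 1` carries the factor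
`Σ_z ‖Ǩ_L(0)(z)‖(1+|z|) = 0`).  Sorry-free; no definition.
-/

noncomputable section

namespace Summit.HubbardSuperconductivity.HubbardSuperconductivity.Theorems.TwoVolumeDefect

open Finset Literature.MathematicalPhysics.QuantumLattice GrassmannAlgebra Literature.Probability.LatticeModels
  Literature.Probability.LatticeModels.BattleFederbush
open Summit.HubbardSuperconductivity.HubbardSuperconductivity.Theorems.EngineV8
open Summit.HubbardSuperconductivity.HubbardSuperconductivity.Theorems.KLRegimeSplit
open scoped Nat

variable {L M : ℕ} [NeZero L] [NeZero M]

/-- **ONE-VOLUME SCALE-`0` GRID DATA AT THE BARE FRAME.**  Gram property (`κ₀ = √(2(7+6047))`), unit grid partition function and the weighted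
pinned profile of the bare grid effective action, from the `gridLabelWt`-weighted row/column sums `≤ αw` of `G = S_Lᵀ C⁰ S_L` and `θ₀ < 1`. -/
theorem scaleZero_gridData {R : RenConsts} {U : ℝ} {Nfr : ℕ} {μ : ℝ} (hK : FrameOK R U Nfr μ 0) {β : ℝ} (hβ : klBetaMin ≤ β)
    (hβL : β ≤ L)
    {αw : ℝ} (hαw : 0 < αw)
    (hrow : ∀ X, ∑ Y, ‖((hubbardGridSub L M β (2 * (2 * M))).transpose * hubbardCovAboveCT L M β μ 0 0 klE0 *
        hubbardGridSub L M β (2 * (2 * M))) X Y‖ * gridLabelWt L (2 * (2 * M)) β {gridLegPos X, gridLegPos Y} ≤ αw)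
    (hcol : ∀ Y, ∑ X, ‖((hubbardGridSub L M β (2 * (2 * M))).transpose * hubbardCovAboveCT L M β μ 0 0 klE0 *
        hubbardGridSub L M β (2 * (2 * M))) X Y‖ * gridLabelWt L (2 * (2 * M)) β {gridLegPos X, gridLegPos Y} ≤ αw)
    {ρ : ℝ} (hρ : 0 < ρ)
    (hθ : Real.exp 1 * αw * normV (GridLeg (GridPoint L (2 * (2 * M)))) (Real.sqrt (2 * (7 + 6047))) ρ
      (fun m' : ℕ => if m' = 1 then |β| / (2 * (2 * M) : ℕ) * ∑ z : TorusSite 2 L, ‖framePosKernel L (0 : TrigPolyC4v) z‖ * (1 + torusSiteDist z 0)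
        else if m' = 2 then |U| * |β| / (2 * (2 * M) : ℕ) else 0) / Real.sqrt (2 * (7 + 6047)) ^ 2 < 1) :
    IsGramBoundedR ((hubbardGridSub L M β (2 * (2 * M))).transpose * hubbardCovAboveCT L M β μ 0 0 klE0 *
        hubbardGridSub L M β (2 * (2 * M))) (Real.sqrt (2 * (7 + 6047))) ∧
      IsUnit (effPartitionFn ℂ ((hubbardGridSub L M β (2 * (2 * M))).transpose * hubbardCovAboveCT L M β μ 0 0 klE0 *
        hubbardGridSub L M β (2 * (2 * M))) (hubbardGridInteraction L (2 * (2 * M)) β U)) ∧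
      ∀ (m' : ℕ) (j : Fin (2 * m')) (x : GridLeg (GridPoint L (2 * (2 * M)))),
        ∑ Y ∈ univ.filter (fun Y : Fin (2 * m') → GridLeg (GridPoint L (2 * (2 * M))) => Y j = x),
          ‖kernel ℂ (effAction ℂ ((hubbardGridSub L M β (2 * (2 * M))).transpose * hubbardCovAboveCT L M β μ 0 0 klE0 *
              hubbardGridSub L M β (2 * (2 * M))) (hubbardGridInteraction L (2 * (2 * M)) β U)) (2 * m') Y‖ *
            (1 + labelDiam (fun Y₁ Y₂ : GridLeg (GridPoint L (2 * (2 * M))) => (Torus.tnorm (Y₁.1.1.2 - Y₂.1.1.2) : ℝ)) (univ.image Y)) ≤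
          ρ⁻¹ ^ (2 * m') * (Real.exp 1 * normV (GridLeg (GridPoint L (2 * (2 * M)))) (Real.sqrt (2 * (7 + 6047))) ρ
            (fun m' : ℕ => if m' = 1 then |β| / (2 * (2 * M) : ℕ) * ∑ z : TorusSite 2 L, ‖framePosKernel L (0 : TrigPolyC4v) z‖ * (1 + torusSiteDist z 0)
              else if m' = 2 then |U| * |β| / (2 * (2 * M) : ℕ) else 0)) /
            (1 - Real.exp 1 * αw * normV (GridLeg (GridPoint L (2 * (2 * M)))) (Real.sqrt (2 * (7 + 6047))) ρ
              (fun m' : ℕ => if m' = 1 then |β| / (2 * (2 * M) : ℕ) * ∑ z : TorusSite 2 L, ‖framePosKernel L (0 : TrigPolyC4v) z‖ * (1 + torusSiteDist z 0)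
                else if m' = 2 then |U| * |β| / (2 * (2 * M) : ℕ) else 0) / Real.sqrt (2 * (7 + 6047)) ^ 2) := by
  classical
  set G := (hubbardGridSub L M β (2 * (2 * M))).transpose * hubbardCovAboveCT L M β μ 0 0 klE0 * hubbardGridSub L M β (2 * (2 * M)) with hG
  have hβ0 : 0 ≤ β := le_trans (by norm_num [klBetaMin]) hβ
  -- Gram property at the bare frame
  have hGB : IsGramBoundedR G (Real.sqrt (2 * (7 + 6047))) :=
    isGramBoundedR_scaleZero_of_frameOK_sharp (L := L) (M := M) hK hβ hβL
  have hκ : 0 < Real.sqrt (2 * (7 + 6047)) := Real.sqrt_pos.2 (by norm_num)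
  -- the `(1 + tnorm)` pair weight is dominated by `gridLabelWt {pos X, pos Y}`
  have hwt : ∀ X Y : GridLeg (GridPoint L (2 * (2 * M))),
      1 + (Torus.tnorm (X.1.1.2 - Y.1.1.2) : ℝ) ≤ gridLabelWt L (2 * (2 * M)) β {gridLegPos X, gridLegPos Y} := by
    intro X Y
    have h := one_add_labelDiam_tnorm_le_gridLabelWt (L := L) (Ng := 2 * (2 * M)) hβ0 ({X, Y} : Finset _)
    rw [labelDiam_pair isLabelDist_tnorm_site, Finset.image_insert, Finset.image_singleton] at h
    exact h
  have hrow' : ∀ X, ∑ Y, ‖G X Y‖ * (1 + (Torus.tnorm (X.1.1.2 - Y.1.1.2) : ℝ)) ≤ αw := fun X =>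
    (sum_le_sum fun Y _ => mul_le_mul_of_nonneg_left (hwt X Y) (norm_nonneg _)).trans (hrow X)
  have hcol' : ∀ Y, ∑ X, ‖G X Y‖ * (1 + (Torus.tnorm (X.1.1.2 - Y.1.1.2) : ℝ)) ≤ αw := fun Y =>
    (sum_le_sum fun X _ => mul_le_mul_of_nonneg_left (hwt X Y) (norm_nonneg _)).trans (hcol Y)
  -- the weighted profile of the grid effective action (general frame lemma at `K = 0`)
  obtain ⟨hZ, hprof⟩ := isUnit_and_weightedProfile_of_gridData (L := L) (Ng := 2 * (2 * M)) G hκ hGB β U (0 : TrigPolyC4v) hαw hrow' hcol' hρ hθ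
  -- the bare frame has no grid counterterm
  have hct : hubbardGridCounterQuadratic L (2 * (2 * M)) β (0 : TrigPolyC4v) = 0 := by
    have hker : ∀ z : TorusSite 2 L, framePosKernel L (0 : TrigPolyC4v) z = 0 := fun z => by
      rw [framePosKernel]; simp [TrigPolyC4v.eval_zero]
    rw [hubbardGridCounterQuadratic]; simp [hker]
  rw [hct, add_zero] at hZ
  refine ⟨hGB, hZ, fun m' j x => ?_⟩
  have h := hprof m' j x
  rw [hct, add_zero] at h
  exact h

end Summit.HubbardSuperconductivity.HubbardSuperconductivity.Theorems.TwoVolumeDefect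

end
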